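import Literature.MathematicalPhysics.QuantumFieldTheory.LatticeYangMillsBakryEmery
import Literature.MathematicalPhysics.QuantumFieldTheory.SUNBakryEmeryPoincare
import HarnessLib

/-!
# The mass-gap step of Shen–Zhu–Zhu for `SU(N)` lattice Yang–Mills, with the Hessian constant as
# a parameter (CMP 400 (2023) 805–851, §4.3: Lemma 4.10, Corollary 4.11, Remark 4.12)

Shen–Zhu–Zhu derive exponential decay of correlations ("mass gap") at strong coupling in §4.3 of
arXiv:2204.12737v1 (= CMP 400 (2023) 805–851, numbering identical):

* **Corollary 4.11** (p. 28). "Suppose that Assumption 1.1 holds. For `f, g ∈ C^∞_cyl(Q)`, suppose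
  that `Λ_f ∩ Λ_g = ∅`. Then one has
  `cov(f,g) ≤ c₁ d(𝔤) e^{-c_N d(Λ_f,Λ_g)} (⦀f⦀_∞ ⦀g⦀_∞ + ‖f‖_{L²} ‖g‖_{L²})`,
  where `c₁` depends on `|Λ_f|, |Λ_g|`, and `c_N` depends on `K_S`, `N` and `d`. Here the covariance
  and `L²` are with respect to every tight limit of `{μ_{Λ_L,N,β}}_L`." (`⦀f⦀_∞ = Σ_{e∈Λ_f} ‖∇_e f‖_{L^∞}`,
  p. 25; `d(Λ_f,Λ_g)` the distance of the edge sets; together with the uniqueness of §5 this is their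
  Corollary 1.6.)
* Its **proof** (p. 28–30, "an argument essentially from [GZ03, §8.3]") uses exactly two inputs:
  (a) the Poincaré inequality of Corollary 4.4, (4.11), for the finite-volume measures `μ_{Λ_L,N,β}`
  uniformly in `L`, in the semigroup form of Remark 4.6, `Var(P_t^L f) ≤ e^{-2tK_S} ‖f‖²_{L²(μ_L)}`
  — this is the ONLY place where Assumption 1.1 / the constant `K_S` enters; and
  (b) **Lemma 4.10** (p. 27): `|[v_e^i, L_L] f(Q)| ≤ Σ_{ē∼e} a_{e,ē} |∇_ē f(Q)|` with
  `a_{e,ē} = N|β|√d(𝔤)` (`e ≠ ē`) and `a_{e,e} = 2(d-1)N|β|(√d(𝔤) + √2 N^{1/2} γ)`, `γ = 3√2` for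
  `SU(N)`, whose proof uses only the TERMWISE bounds `|v_e^i v_ē^j S| ≤ N|β|` (`e ≠ ē`),
  `|v_e^i v_e^j S| ≤ 2(d-1)N|β|` and `|∇_e S| ≤ 2(d-1)N^{3/2}|β|γ/γ₁` ((4.3)–(4.4), (3.3)) and the
  Lie-bracket Lemma 4.9 — none of which involves the total Hessian constant `8(d-1)` of Lemma 4.1.
  Remark 4.12: "`c_N ∼ K_S/(d(𝔤)(a_{e,e} + 6(d-1)a_{e,ē}))`, but this is not necessarily optimal."
* Input (a) is obtained (Theorem 4.2 / Cor. 4.4, p. 19) from the Bakry–Émery condition (4.7),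
  `Ric - Hess_S ≥ K_S`, i.e. from `Ric = N/2` ((4.8)) and Lemma 4.1's `|Hess_S(v,v)| ≤ 8(d-1)N|β||v|²`.

Hence the chain Lemma 4.1 → (4.7) → Cor. 4.4 / Remark 4.6 → Cor. 4.11 uses Lemma 4.1 ONLY through the
constant in (4.7). This file types Corollary 4.11 AS PRINTED (`shenZhuZhu_massGap_tightLimits`, in the
Lipschitz-cylinder rendering already used for the tree's `shen_zhu_zhu`, clause (ii)) and the same
statement with the Hessian constant of Lemma 4.1 as a parameter `Λ₀` (`shenZhuZhu_massGap_transfer`):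
IF `|Hess_S(v,v)| ≤ Λ₀N|β||v|²` on every torus (`WilsonHessianBound d N Λ₀`, the hypothesis shape of the
sibling file `LatticeYangMillsBakryEmery`) and `K := N/2 - N|β|Λ₀ > 0`, THEN every tight limit of the
torus states clusters exponentially in the form of Cor. 4.11 (`SZZExponentialClustering d N β`). With
`Λ₀ = 8(d-1)` this is literally Corollary 4.11 (`shenZhuZhu_massGap_tightLimits_of_transfer`). The
companion fact `shenZhuZhu_bakryEmery_transfer` (same parameterisation of Theorem 4.2 / Cor. 4.5) is
the functional-inequality half; the venture `Summits/Ventures/YMGap` proves `WilsonHessianBound d N (4d)`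
(kernel-checked sharp Hessian constant) and so obtains clustering of every tight limit for
`|β| < 1/(8d)` conditionally on this named fact.

Consistency with the tree: the printed statement `shenZhuZhu_massGap_tightLimits d N` FOLLOWS from the
tree's (proved, Dobrushin-route) `shen_zhu_zhu d N` because tight limits are DLR states
(`mem_ymGibbsMeasures_of_mem_infiniteVolumeLimitPoints_holds`): `shenZhuZhu_massGap_tightLimits_of_shen_zhu_zhu`,
hence it HOLDS unconditionally (`shenZhuZhu_massGap_tightLimits_holds`, via `shen_zhu_zhu_holds`). Only the
parameterised statement `shenZhuZhu_massGap_transfer` is an unproved named fact.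

Not here: the proof of the transfer fact beyond the printed window (it needs the multi-link
Bakry–Émery criterion on `SU(N)^{E⁺}` and the semigroup argument of [GZ03, §8.3], neither in the
tree); DLR uniqueness (Theorem 1.2, whose §5 proof uses the per-edge estimate (5.12) with its own
constant `(4+4√a)(d-1)`, NOT the global Hessian constant — deliberately not parameterised here); the
`SO(N)` case.
-- TODO(general form): Cor. 4.11 is printed with SZZ's first-derivative seminorms `⦀f⦀_∞⦀g⦀_∞` for
--   smooth cylinder functions; as in `shen_zhu_zhu` they are rendered by per-link Lipschitz constants
--   `K₁K₂` and an `n`-dependent `c₁` (`⦀f⦀_∞ ≤ |Λ_f|·K_f` up to the metric comparison of §2).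

## References

* H. Shen, R. Zhu, X. Zhu, CMP 400 (2023) 805–851 = arXiv:2204.12737v1: §4.3 p. 25–30 — Lemma 4.9
  p. 25, Lemma 4.10 p. 27, Corollary 4.11 p. 28 with proof p. 28–30, Remark 4.12 p. 30; Theorem 4.2,
  (4.7)–(4.8), Cor. 4.4 (4.11) p. 19; Remark 4.6 p. 20; Corollary 1.6 p. 7 [ShenZhuZhuCMP2023].
* A. Guionnet, B. Zegarlinski, *Lectures on logarithmic Sobolev inequalities*, Séminaire de
  Probabilités XXXVI, LNM 1801 (2003) 1–134, §8.3 (SZZ's [GZ03]).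
-/

noncomputable section

open MeasureTheory ProbabilityTheory
open scoped NNReal
open Literature.MathematicalPhysics.QuantumLattice

namespace Literature.MathematicalPhysics.QuantumFieldTheory

variable {d N : ℕ}

variable (d N) in
/-- The CONCLUSION of Shen–Zhu–Zhu's Corollary 4.11 at 't Hooft coupling `β` (tree coupling `Nβ`),
in the Lipschitz-cylinder rendering of the tree's `shen_zhu_zhu` (clause (ii)) but, as printed in
Cor. 4.11, for every TIGHT LIMIT `μ` of the torus states `μ_{Λ_L,N,β}` (`infiniteVolumeLimitPoints`):
there is a rate `c > 0` and, for every bound `n` on the support sizes, a constant `c₁` such that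
`|Cov_μ(F₁,F₂)| ≤ c₁ e^{-c d(Λ₁,Λ₂)} (K₁K₂ + ‖F₁‖_{L²(μ)}‖F₂‖_{L²(μ)})` for Lipschitz cylinder functions
`Fᵢ` with disjoint edge supports `Λᵢ`, `|Λᵢ| ≤ n`, per-link Lipschitz constants `Kᵢ`. Printed:
"`cov(f,g) ≤ c₁ d(𝔤) e^{-c_N d(Λ_f,Λ_g)}(⦀f⦀_∞⦀g⦀_∞ + ‖f‖_{L²}‖g‖_{L²})` … with respect to every tight
limit of `{μ_{Λ_L,N,β}}_L`". [cite: ShenZhuZhuCMP2023, Corollary 4.11] -/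
def SZZExponentialClustering (β : ℝ) : Prop :=
  ∀ μ ∈ infiniteVolumeLimitPoints (d := d) (fundamentalRep (Fin N)) ((N : ℝ) * β),
    ∃ c : ℝ, 0 < c ∧ ∀ n : ℕ, ∃ c₁ : ℝ,
      ∀ (F₁ F₂ : LGConfig d (Matrix.specialUnitaryGroup (Fin N) ℂ) → ℝ)
        (Λ₁ Λ₂ : Finset (ZdEdge d)) (K₁ K₂ : ℝ≥0),
        Λ₁.card ≤ n → Λ₂.card ≤ n → Disjoint Λ₁ Λ₂ →
        IsLipschitzCylinder (fundamentalRep (Fin N)) F₁ Λ₁ K₁ →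
        IsLipschitzCylinder (fundamentalRep (Fin N)) F₂ Λ₂ K₂ →
          |cov[F₁, F₂; μ]| ≤ c₁ * Real.exp (-c * setDistEdges Λ₁ Λ₂) *
            ((K₁ : ℝ) * K₂ + Real.sqrt (∫ U, F₁ U ^ 2 ∂μ) * Real.sqrt (∫ U, F₂ U ^ 2 ∂μ))

variable (d N) in
/-- **Shen–Zhu–Zhu, Corollary 4.11 (mass gap for every tight limit), as printed.** Let `G = SU(N)`,
`N ≥ 2`, `d ≥ 2`, and `|β| < 1/(16(d-1))` (Assumption 1.1: `K_S = N/2 - 8N|β|(d-1) > 0`). Then every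
tight limit of the periodic finite-volume measures `μ_{Λ_L,N,β}` ('t Hooft-scaled Wilson action
`Nβ Σ_p Re Tr Q_p`, tree coupling `Nβ`) has exponentially decaying covariances of cylinder functions
with disjoint supports, `SZZExponentialClustering d N β`. [cite: ShenZhuZhuCMP2023, Corollary 4.11] -/
def shenZhuZhu_massGap_tightLimits : Prop :=
  ∀ (_ : 2 ≤ d) (_ : 2 ≤ N) (β : ℝ), |β| < szzThresholdSU d → SZZExponentialClustering d N β

/-- **Consistency with the tree.** Corollary 4.11 as printed follows from the tree's named fact
`shen_zhu_zhu d N` (Thm. 1.2 + Cor. 1.6 in DLR form; proved in the tree by the Dobrushin route,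
`shen_zhu_zhu_holds`), because every tight limit of the torus states is a DLR state
(`mem_ymGibbsMeasures_of_mem_infiniteVolumeLimitPoints_holds`, Georgii Thm. 4.17).
[cite: ShenZhuZhuCMP2023, Corollary 4.11] -/
theorem shenZhuZhu_massGap_tightLimits_of_shen_zhu_zhu (h : shen_zhu_zhu d N) :
    shenZhuZhu_massGap_tightLimits d N := by
  intro hd hN β hβ μ hμ
  haveI : SecondCountableTopology (Matrix (Fin N) (Fin N) ℂ) :=
    inferInstanceAs (SecondCountableTopology (Fin N → Fin N → ℂ))
  haveI : SecondCountableTopology (Matrix.specialUnitaryGroup (Fin N) ℂ) :=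
    Topology.IsEmbedding.subtypeVal.secondCountableTopology
  have hG : μ ∈ ymGibbsMeasures (d := d) (fundamentalRep (Fin N)) ((N : ℝ) * β) :=
    mem_ymGibbsMeasures_of_mem_infiniteVolumeLimitPoints_holds (fundamentalRep (Fin N))
      (continuous_fundamentalRep (Fin N)) hμ
  have hβ' : |β| < 1 / (16 * ((d : ℝ) - 1)) := by simpa [szzThresholdSU] using hβ
  exact (h hd hN β hβ').2 μ hG

/-- **Corollary 4.11 as printed HOLDS in the tree** (no hypothesis): by the tree's theorem
`shen_zhu_zhu_holds` (Dobrushin route to Thm. 1.2 + Cor. 1.6, `SUNBakryEmeryPoincare`) and the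
previous lemma. So of the two statements in this file only the parameterised one,
`shenZhuZhu_massGap_transfer`, is literature debt. [cite: ShenZhuZhuCMP2023, Corollary 4.11] -/
theorem shenZhuZhu_massGap_tightLimits_holds : shenZhuZhu_massGap_tightLimits d N :=
  shenZhuZhu_massGap_tightLimits_of_shen_zhu_zhu (shen_zhu_zhu_holds d N)

variable (d N) in
/-- **Shen–Zhu–Zhu's mass-gap step, Hessian constant as a parameter** (CMP 400 (2023): Theorem 4.2
via (4.7)–(4.8), Cor. 4.4 (4.11), Remark 4.6, Lemma 4.10, Corollary 4.11 with its proof p. 28–30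
"essentially from [GZ03, §8.3]"). On `SU(N)^{E⁺(Λ_L)}` with the Hilbert–Schmidt bi-invariant metric,
`Ric(v,v) = (N/2)|v|²` ((4.8)); if the Wilson action `S = Nβ Σ_p Re Tr Q_p` satisfies
`|Hess_S(v,v)| ≤ Λ₀N|β||v|²` on every torus (`WilsonHessianBound d N Λ₀`), then
`Ric - Hess_S ≥ K := N/2 - N|β|Λ₀` ((4.7) with this constant), so for `K > 0` the finite-volume
measures satisfy the Poincaré inequality (4.11) with constant `1/K` uniformly in `L`
(`Var(P_t^L f) ≤ e^{-2tK}‖f‖²`, Remark 4.6), and the proof of Corollary 4.11 — this Poincaré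
inequality plus the commutator bound of Lemma 4.10, whose constants `a_{e,ē} = N|β|√d(𝔤)`,
`a_{e,e} = 2(d-1)N|β|(√d(𝔤)+√2N^{1/2}γ)` do not involve the Hessian constant — gives exponential
clustering of every tight limit with a rate `c = c(K, N, d) > 0`: `SZZExponentialClustering d N β`.
As printed the statement is the case `Λ₀ = 8(d-1)` supplied by Lemma 4.1
(`shenZhuZhu_massGap_tightLimits_of_transfer`); the proof uses Lemma 4.1 only through the constant in
(4.7). [cite: ShenZhuZhuCMP2023, Corollary 4.11] -/
def shenZhuZhu_massGap_transfer : Prop :=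
  ∀ (Λ₀ : ℝ), 0 ≤ Λ₀ → WilsonHessianBound d N Λ₀ →
    ∀ (_ : 2 ≤ d) (_ : 2 ≤ N) (β : ℝ), 0 < (N : ℝ) / 2 - N * |β| * Λ₀ →
      SZZExponentialClustering d N β

/-- **Consistency with the printed corollary**: the transfer fact together with the Hessian bound
of Lemma 4.1 (`Λ₀ = 8(d-1)`) yields exactly Corollary 4.11 as printed
(`shenZhuZhu_massGap_tightLimits`). [cite: ShenZhuZhuCMP2023, Corollary 4.11] -/
theorem shenZhuZhu_massGap_tightLimits_of_transfer (h : shenZhuZhu_massGap_transfer d N)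
    (hH : WilsonHessianBound d N (8 * ((d : ℝ) - 1))) : shenZhuZhu_massGap_tightLimits d N := by
  intro hd hN β hβ
  have hd' : (2 : ℝ) ≤ d := by exact_mod_cast hd
  have hΛ : (0 : ℝ) ≤ 8 * ((d : ℝ) - 1) := by nlinarith
  have hK : 0 < (N : ℝ) / 2 - N * |β| * (8 * ((d : ℝ) - 1)) := by
    rw [← szzBakryEmeryConstSU_eq_transfer]
    exact (szzBakryEmeryConstSU_pos_iff hd (le_trans one_le_two hN) β).2 hβ
  exact h _ hΛ hH hd hN β hK

/-- The transfer constant is monotone in `Λ₀`: a smaller certified Hessian constant gives a larger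
window `{β : N/2 - N|β|Λ₀ > 0} = {|β| < 1/(2Λ₀)}`. [cite: ShenZhuZhuCMP2023, Assumption 1.1] -/
theorem transferConst_pos_mono {Λ₀ Λ₁ : ℝ} (hle : Λ₀ ≤ Λ₁) {β : ℝ}
    (h : 0 < (N : ℝ) / 2 - N * |β| * Λ₁) : 0 < (N : ℝ) / 2 - N * |β| * Λ₀ := by
  have hN : (0 : ℝ) ≤ N * |β| := mul_nonneg (Nat.cast_nonneg N) (abs_nonneg β)
  nlinarith [mul_le_mul_of_nonneg_left hle hN]

/-- For `N ≥ 1` and `Λ₀ > 0`: `N/2 - N|β|Λ₀ > 0 ↔ |β| < 1/(2Λ₀)` — the window of the transfer facts.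
[cite: ShenZhuZhuCMP2023, (1.3)] -/
theorem transferConst_pos_iff (hN : 1 ≤ N) {Λ₀ : ℝ} (hΛ : 0 < Λ₀) (β : ℝ) :
    0 < (N : ℝ) / 2 - N * |β| * Λ₀ ↔ |β| < 1 / (2 * Λ₀) := by
  have hN' : (0 : ℝ) < N := by exact_mod_cast hN
  rw [lt_div_iff₀ (by positivity)]
  constructor
  · intro h
    nlinarith [abs_nonneg β]
  · intro h
    nlinarith [abs_nonneg β]

end Literature.MathematicalPhysics.QuantumFieldTheory
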